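import Literature.MathematicalPhysics.QuantumLattice.SL2COneParameter
import Mathlib.Analysis.SpecialFunctions.Complex.Arg
import Mathlib.Analysis.SpecialFunctions.Complex.Log
import HarnessLib

/-!
# The PCT matrix of a continuous finite-dimensional representation of `SL(2, ℂ)`

Topic `Literature/MathematicalPhysics/QuantumLattice` (trunk T-AQFT), continuation of
`SL2COneParameter`. For an arbitrary *continuous* finite-dimensional representation
`S : SL(2, ℂ) →* M_ι(ℂ)` (no classification of irreducibles, no complete reducibility) we construct
the matrix that appears in the PCT theorem for fields of general spin (Streater–Wightman (1964),
§4-3, Thm. 4-7 and eqs. (4-29)–(4-32): the continuation `S(A, B)` of `S(A) = S(A, Ā)` to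
`SL(2,C) ⊗ SL(2,C)` evaluated at the total inversion, "`Λ(−1, 1) = Λ(1, −1) = −1`", which on the
irreducible `𝒟^{(j/2, k/2)}` is `(−1)^j` resp. `(−1)^k`).

The total space-time inversion `−1 ∈ L₊(ℂ)` is `B(iπ) ∘ R`, the boost of imaginary rapidity `iπ`
in the `(0, 3)`-plane followed by the *real* rotation `R` by `π` about the `3`-axis, covered by
`A_R = diag(i, −i) ∈ SL(2, ℂ)` (`rot3 (π/2)`). Accordingly, with `H` the generator of the image of the
diagonal subgroup `diag(e^t, e^{−t})` (`SL2C.gen S hS hMat`, so that the boost of rapidity `χ` is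
sent to `exp ((χ/2) H)`):

* `SL2C.pctMatrix S hS = S(A_R)⁻¹ · exp ((iπ/2) H)` — the **PCT matrix** (basis-free form of
  Streater–Wightman's `(−1)^J`, `J` = number of undotted indices);
* `SL2C.exp_genH_conj_apply` — **the continued boost acts like the rotation**:
  `exp ((iπ/2) H) · S(g) · exp (−(iπ/2) H) = S(A_R) · S(g) · S(A_R)⁻¹` for every `g ∈ SL(2, ℂ)`
  (S–W (4-29)–(4-30): both sides are `S(Λ)` continued to the complex Lorentz transformation
  `B(iπ)`, resp. its real shadow). Proof: on the one-parameter subgroups generated by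
  `β e`, `γ f` (`β, γ ∈ ℂ`), `h` and `i h` the real identity
  `e^{sH} · gen ξ · e^{−sH} = gen (diag(e^s, e^{−s}) ξ diag(e^{−s}, e^s)) = e^{±2s} gen ξ`
  (`gen_conj`, `gen_smul` of `SL2COneParameter`) continues to complex `s` (identity theorem), and at
  `s = iπ/2` it coincides with `Ad S(A_R)`; every `g` is a product of such elements (Gauss
  decomposition `g = v(c/a) diag(a, a⁻¹) u(b/a)` for `a ≠ 0`, and `w₀ = u(1) v(−1) u(1)`);
* `SL2C.commute_pctMatrix` — the PCT matrix **commutes with the representation**;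
* `SL2C.pctMatrix_mul_self` — it is an **involution**, `C² = S(A_R)⁻² exp (iπ H) = S(−1) S(−1) = 1`
  (by `exp_pi_mul_I_smul_genH : exp (iπ H) = S(−1)` of `SL2COneParameter`);
* `SL2C.pctMatrix_one` — for the trivial representation `C = 1`.

These are exactly the three properties of the matrices `C k` demanded by the basis-free PCT
statement `Literature.Analysis.FunctionSpaces.pct_theorem`.

## References

* R. F. Streater, A. S. Wightman, *PCT, Spin and Statistics, and All That* (1964; Princeton 2000),
  §1-3 eqs. (1-26)–(1-30), §4-3 eqs. (4-29)–(4-32), Thm. 4-7. [StreaterWightman1964]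
* B. C. Hall, *Lie Groups, Lie Algebras, and Representations*, 2nd ed. (2015), Thm. 3.28. [Hall2015]

## Mathlib / tree

`Matrix.SpecialLinearGroup`, `NormedSpace.exp`, `Complex.norm_mul_exp_arg_mul_I` (polar form),
`AnalyticOnNhd.eqOn_of_preconnected_of_frequently_eq`; from the tree `SL2C.gen`, `gen_conj`,
`gen_smul`, `commute_gen`, `exp_pi_mul_I_smul_genH`, `eq_exp_smul_of_hasDerivAt`
(`SL2COneParameter`), `generator_unique` (`NormContinuousGroup`).
-/

noncomputable section

open NormedSpace Filter Set Complex
open _root_.Topology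
open scoped Matrix.Norms.Operator MatrixGroups Real

namespace Literature.MathematicalPhysics.QuantumLattice

namespace SL2C

/-! ### The nilpotent generators `e`, `f` and the unipotent subgroups -/

/-- `e = !![0, 1; 0, 0]`. [cite: StreaterWightman1964, §1-3] -/
def eMat : M2 := !![0, 1; 0, 0]

/-- `f = !![0, 0; 1, 0]`. [cite: StreaterWightman1964, §1-3] -/
def fMat : M2 := !![0, 0; 1, 0]

/-- `(β e)² = 0`. [folklore] -/
theorem smul_eMat_sq (β : ℂ) : (β • eMat) * (β • eMat) = 0 := by
  ext i j; fin_cases i <;> fin_cases j <;> simp [eMat]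

/-- `(γ f)² = 0`. [folklore] -/
theorem smul_fMat_sq (γ : ℂ) : (γ • fMat) * (γ • fMat) = 0 := by
  ext i j; fin_cases i <;> fin_cases j <;> simp [fMat]

/-- The unipotent one-parameter group `1 + t X` generated by a matrix with `X² = 0`: group law.
[folklore] -/
theorem unipGroup_mul {X : M2} (hX : X * X = 0) (s t : ℝ) :
    ((1 : M2) + (s : ℂ) • X) * ((1 : M2) + (t : ℂ) • X) = (1 : M2) + ((s + t : ℝ) : ℂ) • X := by
  simp only [mul_add, add_mul, one_mul, mul_one, smul_mul_smul_comm, hX, smul_zero, add_zero]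
  push_cast
  rw [add_smul]
  abel

/-- Derivative of the unipotent group at `0` is its generator. [folklore] -/
theorem hasDerivAt_unipGroup_zero (X : M2) :
    HasDerivAt (fun t : ℝ => (1 : M2) + (t : ℂ) • X) X 0 := by
  have h := (((hasDerivAt_id (0 : ℝ)).ofReal_comp).smul_const X).const_add (1 : M2)
  simp only [id, Complex.ofReal_one, one_smul] at h
  exact h

/-- Continuity of the unipotent group. [folklore] -/
theorem continuous_unipGroup (X : M2) : Continuous fun t : ℝ => (1 : M2) + (t : ℂ) • X :=
  continuous_const.add (Complex.continuous_ofReal.smul continuous_const)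

/-- **`1 + t X = exp (t X)`** for `X² = 0`. [cite: Hall2015, Thm 2.11] -/
theorem unipGroup_eq_exp {X : M2} (hX : X * X = 0) (t : ℝ) : (1 : M2) + (t : ℂ) • X = exp (t • X) :=
  eq_exp_smul_of_hasDerivAt (g := fun t : ℝ => (1 : M2) + (t : ℂ) • X) (continuous_unipGroup X)
    (by simp) (fun s t => (unipGroup_mul hX s t).symm) (hasDerivAt_unipGroup_zero X) t

/-- `β e` generates a one-parameter subgroup of `SL(2, ℂ)`: `det (1 + t β e) = 1`. [folklore] -/
theorem isGen_smul_eMat (β : ℂ) : IsGen (β • eMat) := fun t => by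
  rw [← unipGroup_eq_exp (smul_eMat_sq β), Matrix.det_fin_two]
  simp [eMat]

/-- `γ f` generates a one-parameter subgroup of `SL(2, ℂ)`: `det (1 + t γ f) = 1`. [folklore] -/
theorem isGen_smul_fMat (γ : ℂ) : IsGen (γ • fMat) := fun t => by
  rw [← unipGroup_eq_exp (smul_fMat_sq γ), Matrix.det_fin_two]
  simp [fMat]

/-- The upper unipotent `u(β) = !![1, β; 0, 1] = exp (β e)`. [cite: StreaterWightman1964, §1-3] -/
theorem coe_toSL_smul_eMat_one (β : ℂ) : (toSL (β • eMat) (isGen_smul_eMat β) 1 : M2) = !![1, β; 0, 1] := by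
  rw [coe_toSL, ← unipGroup_eq_exp (smul_eMat_sq β)]
  ext i j; fin_cases i <;> fin_cases j <;> simp [eMat]

/-- The lower unipotent `v(γ) = !![1, 0; γ, 1] = exp (γ f)`. [cite: StreaterWightman1964, §1-3] -/
theorem coe_toSL_smul_fMat_one (γ : ℂ) : (toSL (γ • fMat) (isGen_smul_fMat γ) 1 : M2) = !![1, 0; γ, 1] := by
  rw [coe_toSL, ← unipGroup_eq_exp (smul_fMat_sq γ)]
  ext i j; fin_cases i <;> fin_cases j <;> simp [fMat]

/-! ### The compact diagonal subgroup `diag(e^{iθ}, e^{−iθ}) = exp (θ · i h)` -/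

/-- `(i h)² = −1`. [folklore] -/
theorem I_smul_hMat_sq : ((I : ℂ) • hMat) * ((I : ℂ) • hMat) = -1 := by
  rw [smul_mul_smul_comm, hMat_sq, I_mul_I, neg_smul, one_smul]

/-- The rotations about the `3`-axis in `SL(2, ℂ)`: `diag(e^{iθ}, e^{−iθ}) = cos θ · 1 + sin θ · (i h)`.
[cite: StreaterWightman1964, §1-3 eq. (1-27)] -/
def rot3Grp (θ : ℝ) : M2 := (Real.cos θ : ℂ) • (1 : M2) + (Real.sin θ : ℂ) • ((I : ℂ) • hMat)

/-- `diag(e^{iθ}, e^{−iθ}) = exp (θ · i h)`. [cite: StreaterWightman1964, §1-3 eq. (1-27)] -/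
theorem rot3Grp_eq_exp (θ : ℝ) : rot3Grp θ = exp (θ • ((I : ℂ) • hMat)) :=
  eq_exp_smul_of_hasDerivAt (g := rot3Grp) (continuous_circGroup _) (by simp [rot3Grp])
    (fun s t => (circGroup_mul I_smul_hMat_sq s t).symm) (hasDerivAt_circGroup_zero _) θ

/-- `det diag(e^{iθ}, e^{−iθ}) = 1`. [folklore] -/
theorem det_rot3Grp (θ : ℝ) : (rot3Grp θ).det = 1 := by
  have h := Complex.cos_sq_add_sin_sq (θ : ℂ)
  rw [Matrix.det_fin_two]
  simp [rot3Grp, hMat, Matrix.smul_apply]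
  linear_combination h - (Complex.sin θ) ^ 2 * Complex.I_sq

/-- `i h` generates a one-parameter subgroup of `SL(2, ℂ)`. [folklore] -/
theorem isGen_I_smul_hMat : IsGen ((I : ℂ) • hMat) := fun t => by rw [← rot3Grp_eq_exp, det_rot3Grp]

/-- The coercion of the compact diagonal subgroup. [folklore] -/
theorem coe_toSL_I_smul_hMat (θ : ℝ) : (toSL ((I : ℂ) • hMat) isGen_I_smul_hMat θ : M2) = rot3Grp θ := by
  rw [coe_toSL, rot3Grp_eq_exp]

/-- **The rotation by `π` about the `3`-axis**, covered by `A_R = diag(i, −i) = exp ((π/2) i h)`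
(S–W §1-3: `Λ(A_R)` is the rotation `(x¹, x²) ↦ (−x¹, −x²)`). [cite: StreaterWightman1964, §1-3 eq. (1-27)] -/
def rotPi : SL(2, ℂ) := toSL ((I : ℂ) • hMat) isGen_I_smul_hMat (π / 2)

/-- `A_R = diag(i, −i)` as a matrix. [folklore] -/
theorem coe_rotPi : (rotPi : M2) = !![I, 0; 0, -I] := by
  rw [rotPi, coe_toSL_I_smul_hMat, rot3Grp, Real.cos_pi_div_two, Real.sin_pi_div_two]
  ext i j; fin_cases i <;> fin_cases j <;> simp [hMat]

/-- `A_R² = −1` (a rotation by `2π` is `−1` in `SL(2, ℂ)`). [folklore] -/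
theorem rotPi_mul_rotPi : rotPi * rotPi = -1 := by
  apply Subtype.ext
  rw [Matrix.SpecialLinearGroup.coe_mul, coe_rotPi, Matrix.SpecialLinearGroup.coe_neg,
    Matrix.SpecialLinearGroup.coe_one]
  ext i j; fin_cases i <;> fin_cases j <;> simp

/-! ### Conjugation by the diagonal subgroup -/

/-- `diag(e^s, e^{−s}) (β e) diag(e^{−s}, e^{s}) = e^{2s} β e`. [cite: StreaterWightman1964, §1-3] -/
theorem diagGrp_mul_smul_eMat_mul_diagGrp_neg (s : ℝ) (β : ℂ) :
    diagGrp s * (β • eMat) * diagGrp (-s) = ((Real.exp (2 * s) : ℝ) : ℂ) • (β • eMat) := by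
  have h2 : (Real.exp (2 * s) : ℂ) = (Real.cosh s + Real.sinh s) * (Real.cosh s + Real.sinh s) := by
    rw [← Complex.ofReal_add, Real.cosh_add_sinh, ← Complex.ofReal_mul, ← Real.exp_add, two_mul]
  simp only [diagGrp, hMat, eMat, Real.cosh_neg, Real.sinh_neg]
  ext i j
  fin_cases i <;> fin_cases j <;>
    · simp [Matrix.mul_apply, Fin.sum_univ_two, Matrix.smul_apply, Matrix.one_apply,
        -Complex.cosh_add_sinh, -Complex.sinh_add_cosh, -Complex.cosh_sub_sinh, -Complex.sinh_sub_cosh, h2]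
      try ring

/-- `diag(e^s, e^{−s}) (γ f) diag(e^{−s}, e^{s}) = e^{−2s} γ f`. [cite: StreaterWightman1964, §1-3] -/
theorem diagGrp_mul_smul_fMat_mul_diagGrp_neg (s : ℝ) (γ : ℂ) :
    diagGrp s * (γ • fMat) * diagGrp (-s) = ((Real.exp (-(2 * s)) : ℝ) : ℂ) • (γ • fMat) := by
  have h2 : (Real.exp (-(2 * s)) : ℂ) = (Real.cosh s - Real.sinh s) * (Real.cosh s - Real.sinh s) := by
    rw [← Complex.ofReal_sub, Real.cosh_sub_sinh, ← Complex.ofReal_mul, ← Real.exp_add]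
    ring_nf
  simp only [diagGrp, hMat, fMat, Real.cosh_neg, Real.sinh_neg]
  ext i j
  fin_cases i <;> fin_cases j <;>
    · simp [Matrix.mul_apply, Fin.sum_univ_two, Matrix.smul_apply, Matrix.one_apply,
        -Complex.cosh_add_sinh, -Complex.sinh_add_cosh, -Complex.cosh_sub_sinh, -Complex.sinh_sub_cosh, h2]
      try ring

/-- `A_R (β e) A_R⁻¹ = −β e`. [cite: StreaterWightman1964, §1-3] -/
theorem rotPi_mul_smul_eMat_mul_rotPi_inv (β : ℂ) :
    (rotPi : M2) * (β • eMat) * ((rotPi⁻¹ : SL(2, ℂ)) : M2) = ((-1 : ℝ) : ℂ) • (β • eMat) := by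
  rw [rotPi, ← toSL_neg, coe_toSL_I_smul_hMat, coe_toSL_I_smul_hMat]
  simp only [rot3Grp, Real.cos_neg, Real.sin_neg, Real.cos_pi_div_two, Real.sin_pi_div_two, hMat, eMat]
  ext i j
  fin_cases i <;> fin_cases j <;> simp [Matrix.mul_apply, Fin.sum_univ_two, Matrix.smul_apply]
  linear_combination β * Complex.I_sq

/-- `A_R (γ f) A_R⁻¹ = −γ f`. [cite: StreaterWightman1964, §1-3] -/
theorem rotPi_mul_smul_fMat_mul_rotPi_inv (γ : ℂ) :
    (rotPi : M2) * (γ • fMat) * ((rotPi⁻¹ : SL(2, ℂ)) : M2) = ((-1 : ℝ) : ℂ) • (γ • fMat) := by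
  rw [rotPi, ← toSL_neg, coe_toSL_I_smul_hMat, coe_toSL_I_smul_hMat]
  simp only [rot3Grp, Real.cos_neg, Real.sin_neg, Real.cos_pi_div_two, Real.sin_pi_div_two, hMat, fMat]
  ext i j
  fin_cases i <;> fin_cases j <;> simp [Matrix.mul_apply, Fin.sum_univ_two, Matrix.smul_apply]
  linear_combination γ * Complex.I_sq

/-- Diagonal matrices commute: `diag(e^t, e^{−t})` commutes with the subgroup of `h`. [folklore] -/
theorem toSL_hMat_comm (s t : ℝ) :
    toSL hMat isGen_hMat s * toSL hMat isGen_hMat t = toSL hMat isGen_hMat t * toSL hMat isGen_hMat s := by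
  rw [← toSL_add, ← toSL_add, add_comm]

/-- `diag(e^{iθ}, e^{−iθ})` commutes with `diag(e^t, e^{−t})`. [folklore] -/
theorem toSL_I_smul_hMat_mul_toSL_hMat (θ t : ℝ) :
    toSL ((I : ℂ) • hMat) isGen_I_smul_hMat θ * toSL hMat isGen_hMat t =
      toSL hMat isGen_hMat t * toSL ((I : ℂ) • hMat) isGen_I_smul_hMat θ := by
  apply Subtype.ext
  rw [Matrix.SpecialLinearGroup.coe_mul, Matrix.SpecialLinearGroup.coe_mul, coe_toSL_I_smul_hMat, coe_toSL_hMat]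
  simp only [rot3Grp, diagGrp, hMat]
  ext i j
  fin_cases i <;> fin_cases j <;>
    simp [Matrix.mul_apply, Fin.sum_univ_two, -Complex.cosh_add_sinh, -Complex.sinh_add_cosh,
      -Complex.cosh_sub_sinh, -Complex.sinh_sub_cosh, mul_comm]

section Rep

variable {ι : Type*} [Fintype ι] [DecidableEq ι]
variable (S : SL(2, ℂ) →* Matrix ι ι ℂ)

/-! ### Continuation of `Ad (diag(e^s, e^{−s}))` to complex `s` -/

/-- **Real scaling identity**: if `diag(e^s, e^{−s}) ξ diag(e^{−s}, e^s) = e^{cs} ξ` for all real `s`,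
then `e^{sH} · gen ξ · e^{−sH} = e^{cs} gen ξ` (`gen_conj` and `gen_smul`). [cite: Hall2015, Thm 3.28] -/
theorem exp_genH_mul_gen_mul_exp_neg (hS : Continuous S) {ξ : M2} (hξ : IsGen ξ) (c : ℝ)
    (hscale : ∀ s : ℝ, diagGrp s * ξ * diagGrp (-s) = ((Real.exp (c * s) : ℝ) : ℂ) • ξ) (s : ℝ) :
    exp (s • gen S hS hMat isGen_hMat) * gen S hS ξ hξ * exp ((-s) • gen S hS hMat isGen_hMat) =
      Real.exp (c * s) • gen S hS ξ hξ := by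
  set g : SL(2, ℂ) := toSL hMat isGen_hMat s with hg
  have hmat : (g : M2) * ξ * ((g⁻¹ : SL(2, ℂ)) : M2) = (Real.exp (c * s)) • ξ := by
    rw [hg, ← toSL_neg, coe_toSL_hMat, coe_toSL_hMat, hscale s, Complex.coe_smul]
  have h1 : gen S hS _ (isGen_conj g hξ) = S g * gen S hS ξ hξ * S g⁻¹ := gen_conj S hS g hξ _
  have h2 : gen S hS _ (isGen_conj g hξ) = gen S hS _ (isGen_smul (Real.exp (c * s)) hξ) :=
    gen_congr S hS _ _ hmat
  have h3 : gen S hS _ (isGen_smul (Real.exp (c * s)) hξ) = Real.exp (c * s) • gen S hS ξ hξ :=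
    gen_smul S hS _ hξ _
  have hSg : S g = exp (s • gen S hS hMat isGen_hMat) := apply_toSL S hS isGen_hMat s
  have hSg' : S g⁻¹ = exp ((-s) • gen S hS hMat isGen_hMat) := by
    rw [hg, ← toSL_neg, apply_toSL S hS isGen_hMat]
  rw [← hSg, ← hSg', ← h1, h2, h3]

/-- **Complex scaling identity** (identity theorem in the rapidity): under the hypothesis of
`exp_genH_mul_gen_mul_exp_neg`, `e^{zH} · gen ξ · e^{−zH} = e^{cz} gen ξ` for all complex `z`.
[cite: StreaterWightman1964, §4-3 eq. (4-29)] -/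
theorem exp_genH_mul_gen_mul_exp_neg_complex (hS : Continuous S) {ξ : M2} (hξ : IsGen ξ) (c : ℝ)
    (hscale : ∀ s : ℝ, diagGrp s * ξ * diagGrp (-s) = ((Real.exp (c * s) : ℝ) : ℂ) • ξ) (z : ℂ) :
    exp (z • gen S hS hMat isGen_hMat) * gen S hS ξ hξ * exp (z • (-gen S hS hMat isGen_hMat)) =
      Complex.exp (c * z) • gen S hS ξ hξ := by
  set H := gen S hS hMat isGen_hMat
  set G := gen S hS ξ hξ
  set F₁ : ℂ → Matrix ι ι ℂ := fun z => exp (z • H) * G * exp (z • (-H)) with hF₁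
  set F₂ : ℂ → Matrix ι ι ℂ := fun z => Complex.exp (c * z) • G with hF₂
  have hd₁ : Differentiable ℂ F₁ := fun z =>
    (((hasDerivAt_exp_smul_const H z).differentiableAt.mul_const G).mul
      (hasDerivAt_exp_smul_const (-H) z).differentiableAt)
  have hd₂ : Differentiable ℂ F₂ :=
    (Complex.differentiable_exp.comp (differentiable_id.const_mul (c : ℂ))).smul_const G
  have hreal : ∀ s : ℝ, F₁ s = F₂ s := by
    intro s
    have h := exp_genH_mul_gen_mul_exp_neg S hS hξ c hscale s
    simp only [hF₁, hF₂]
    rw [Complex.coe_smul, smul_neg, ← neg_smul, ← Complex.ofReal_neg, Complex.coe_smul, h,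
      show (c : ℂ) * (s : ℂ) = ((c * s : ℝ) : ℂ) by push_cast; ring, ← Complex.ofReal_exp,
      Complex.coe_smul]
  have hfreq : ∃ᶠ w in 𝓝[≠] (0 : ℂ), F₁ w = F₂ w := by
    have ht : Tendsto (fun s : ℝ => (s : ℂ)) (𝓝[≠] 0) (𝓝[≠] 0) := by
      have h := Complex.continuous_ofReal.continuousWithinAt.tendsto_nhdsWithin
        (s := {(0 : ℝ)}ᶜ) (t := {(0 : ℂ)}ᶜ) (x := 0) fun x hx => by
          simpa [Complex.ofReal_eq_zero] using hx
      rwa [Complex.ofReal_zero] at h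
    exact ht.frequently (Eventually.of_forall hreal).frequently
  have heq := AnalyticOnNhd.eqOn_of_preconnected_of_frequently_eq (fun w _ => hd₁.analyticAt w)
    (fun w _ => hd₂.analyticAt w) isPreconnected_univ (mem_univ 0) hfreq
  exact heq (mem_univ z)

/-- The continued boost to rapidity `iπ`: `U = exp ((iπ/2) H)`. [cite: StreaterWightman1964, §4-3 eq. (4-30)] -/
def boostIPi (hS : Continuous S) : Matrix ι ι ℂ := exp ((((π : ℂ) / 2) * I) • gen S hS hMat isGen_hMat)

/-- Its inverse `exp (−(iπ/2) H)`. [folklore] -/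
def boostIPiInv (hS : Continuous S) : Matrix ι ι ℂ := exp ((((π : ℂ) / 2) * I) • (-gen S hS hMat isGen_hMat))

/-- `U U⁻¹ = 1`. [folklore] -/
theorem boostIPi_mul_boostIPiInv (hS : Continuous S) : boostIPi S hS * boostIPiInv S hS = 1 := by
  rw [boostIPi, boostIPiInv, smul_neg]
  have hcomm : Commute ((((π : ℂ) / 2) * I) • gen S hS hMat isGen_hMat)
      (-((((π : ℂ) / 2) * I) • gen S hS hMat isGen_hMat)) := (Commute.refl _).neg_right
  have h := (exp_add_of_commute hcomm).symm
  rwa [add_neg_cancel, NormedSpace.exp_zero] at h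

/-- `U⁻¹ U = 1`. [folklore] -/
theorem boostIPiInv_mul_boostIPi (hS : Continuous S) : boostIPiInv S hS * boostIPi S hS = 1 := by
  rw [boostIPi, boostIPiInv, smul_neg]
  have hcomm : Commute (-((((π : ℂ) / 2) * I) • gen S hS hMat isGen_hMat))
      ((((π : ℂ) / 2) * I) • gen S hS hMat isGen_hMat) := (Commute.refl _).neg_left
  have h := (exp_add_of_commute hcomm).symm
  rwa [neg_add_cancel, NormedSpace.exp_zero] at h

/-- **At rapidity `iπ/2` the continued boost acts on a scaled generator like `A_R`**: if
`diag(e^s, e^{−s}) ξ diag(e^{−s}, e^s) = e^{±2s} ξ` and `A_R ξ A_R⁻¹ = −ξ`, then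
`U · gen ξ · U⁻¹ = S(A_R) · gen ξ · S(A_R)⁻¹ (= −gen ξ)`. [cite: StreaterWightman1964, §4-3 eqs. (4-29)–(4-31)] -/
theorem boostIPi_mul_gen_mul_boostIPiInv (hS : Continuous S) {ξ : M2} (hξ : IsGen ξ) {ε : ℝ}
    (hε : ε = 1 ∨ ε = -1)
    (hscale : ∀ s : ℝ, diagGrp s * ξ * diagGrp (-s) = ((Real.exp ((2 * ε) * s) : ℝ) : ℂ) • ξ)
    (hrot : (rotPi : M2) * ξ * ((rotPi⁻¹ : SL(2, ℂ)) : M2) = ((-1 : ℝ) : ℂ) • ξ) :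
    boostIPi S hS * gen S hS ξ hξ * boostIPiInv S hS = S rotPi * gen S hS ξ hξ * S rotPi⁻¹ := by
  -- left side: the complex scaling identity at `z = iπ/2`
  have hL := exp_genH_mul_gen_mul_exp_neg_complex S hS hξ (2 * ε) hscale (((π : ℂ) / 2) * I)
  have hexp : Complex.exp (((2 * ε : ℝ) : ℂ) * (((π : ℂ) / 2) * I)) = -1 := by
    rcases hε with h | h
    · rw [h, show (((2 * (1 : ℝ) : ℝ)) : ℂ) * ((π : ℂ) / 2 * I) = π * I by push_cast; ring,
        Complex.exp_pi_mul_I]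
    · rw [h, show (((2 * (-1 : ℝ) : ℝ)) : ℂ) * ((π : ℂ) / 2 * I) = -(π * I) by push_cast; ring,
        Complex.exp_neg, Complex.exp_pi_mul_I]
      norm_num
  rw [hexp] at hL
  -- right side: `gen (A_R ξ A_R⁻¹) = gen (−ξ) = −gen ξ`
  have h1 : gen S hS _ (isGen_conj rotPi hξ) = S rotPi * gen S hS ξ hξ * S rotPi⁻¹ := gen_conj S hS rotPi hξ _
  have h2 : gen S hS _ (isGen_conj rotPi hξ) = gen S hS _ (isGen_smul (-1) hξ) := gen_congr S hS _ _ hrot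
  have h3 : gen S hS _ (isGen_smul (-1) hξ) = (-1 : ℝ) • gen S hS ξ hξ := gen_smul S hS _ hξ _
  rw [← h1, h2, h3, boostIPi, boostIPiInv, hL]
  simp

/-- The same conclusion for a generator **commuting** with the diagonal subgroups (`ξ = s₀ h` or
`θ₀ · i h`): both sides equal `gen ξ`. [folklore] -/
theorem boostIPi_mul_gen_mul_boostIPiInv_of_comm (hS : Continuous S) {ξ : M2} (hξ : IsGen ξ)
    (hcommH : ∀ s t : ℝ, toSL hMat isGen_hMat s * toSL ξ hξ t = toSL ξ hξ t * toSL hMat isGen_hMat s)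
    (hcommR : ∀ t : ℝ, rotPi * toSL ξ hξ t = toSL ξ hξ t * rotPi) :
    boostIPi S hS * gen S hS ξ hξ * boostIPiInv S hS = S rotPi * gen S hS ξ hξ * S rotPi⁻¹ := by
  -- `gen ξ` commutes with `H`, hence with `U`
  have hGH : Commute (gen S hS ξ hξ) (gen S hS hMat isGen_hMat) := by
    refine Literature.Analysis.OperatorTheory.commute_generator fun s => ?_
    show Commute (gen S hS ξ hξ) (exp (s • gen S hS hMat isGen_hMat))
    rw [← apply_toSL S hS isGen_hMat s]
    exact (commute_gen S hS (toSL hMat isGen_hMat s) hξ (fun t => hcommH s t)).symm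
  have hGU : Commute (gen S hS ξ hξ) (boostIPi S hS) := (hGH.smul_right _).exp_right
  have hSS : S rotPi * S rotPi⁻¹ = 1 := by rw [← map_mul, mul_inv_cancel, map_one]
  have hGR : Commute (S rotPi) (gen S hS ξ hξ) := commute_gen S hS rotPi hξ hcommR
  rw [← hGU.eq, mul_assoc, boostIPi_mul_boostIPiInv, mul_one, hGR.eq, mul_assoc, hSS, mul_one]

/-- From the generator to the subgroup: if `U · gen ξ · U⁻¹ = S(A_R) · gen ξ · S(A_R)⁻¹` then
`U S(exp tξ) U⁻¹ = S(A_R) S(exp tξ) S(A_R)⁻¹` for all `t`. [cite: Hall2015, Prop 2.3] -/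
theorem boostIPi_mul_apply_toSL_mul_boostIPiInv (hS : Continuous S) {ξ : M2} (hξ : IsGen ξ)
    (h : boostIPi S hS * gen S hS ξ hξ * boostIPiInv S hS = S rotPi * gen S hS ξ hξ * S rotPi⁻¹) (t : ℝ) :
    boostIPi S hS * S (toSL ξ hξ t) * boostIPiInv S hS = S rotPi * S (toSL ξ hξ t) * S rotPi⁻¹ := by
  have hSS : S rotPi * S rotPi⁻¹ = 1 := by rw [← map_mul, mul_inv_cancel, map_one]
  have hSS' : S rotPi⁻¹ * S rotPi = 1 := by rw [← map_mul, inv_mul_cancel, map_one]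
  have ht : t • (boostIPi S hS * gen S hS ξ hξ * boostIPiInv S hS) =
      boostIPi S hS * (t • gen S hS ξ hξ) * boostIPiInv S hS := by simp
  have ht' : t • (S rotPi * gen S hS ξ hξ * S rotPi⁻¹) = S rotPi * (t • gen S hS ξ hξ) * S rotPi⁻¹ := by simp
  have e1 : exp (t • (boostIPi S hS * gen S hS ξ hξ * boostIPiInv S hS)) =
      boostIPi S hS * exp (t • gen S hS ξ hξ) * boostIPiInv S hS :=
    (congrArg NormedSpace.exp ht).trans
      (exp_conj_of_mul_eq_one (boostIPi_mul_boostIPiInv S hS) (boostIPiInv_mul_boostIPi S hS) _)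
  have e2 : exp (t • (S rotPi * gen S hS ξ hξ * S rotPi⁻¹)) = S rotPi * exp (t • gen S hS ξ hξ) * S rotPi⁻¹ :=
    (congrArg NormedSpace.exp ht').trans (exp_conj_of_mul_eq_one hSS hSS' _)
  calc boostIPi S hS * S (toSL ξ hξ t) * boostIPiInv S hS
      = boostIPi S hS * exp (t • gen S hS ξ hξ) * boostIPiInv S hS := by rw [apply_toSL S hS hξ t]
    _ = exp (t • (boostIPi S hS * gen S hS ξ hξ * boostIPiInv S hS)) := e1.symm
    _ = exp (t • (S rotPi * gen S hS ξ hξ * S rotPi⁻¹)) := by rw [h]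
    _ = S rotPi * exp (t • gen S hS ξ hξ) * S rotPi⁻¹ := e2
    _ = S rotPi * S (toSL ξ hξ t) * S rotPi⁻¹ := by rw [apply_toSL S hS hξ t]

/-! ### The PCT matrix -/

/-- **The PCT matrix** of the continuous finite-dimensional representation `S`:
`C = S(A_R)⁻¹ · exp ((iπ/2) H)`, the value at the total inversion `−1 = B(iπ) ∘ R` of the
continued representation, normalised by the real rotation (basis-free form of Streater–Wightman's
`(−1)^J`; on `𝒟^{(j/2,k/2)}` in an adapted basis it is `± (−1)^j`). [cite: StreaterWightman1964, §4-3 eqs. (4-31)–(4-32)] -/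
def pctMatrix (hS : Continuous S) : Matrix ι ι ℂ := S rotPi⁻¹ * boostIPi S hS

/-- The elements of `SL(2, ℂ)` whose image commutes with `S(A_R)⁻¹ U` — those on which the continued
boost acts like the rotation. [folklore] -/
def IsPCTGood (hS : Continuous S) (g : SL(2, ℂ)) : Prop :=
  boostIPi S hS * S g * boostIPiInv S hS = S rotPi * S g * S rotPi⁻¹

/-- `1` is good. [folklore] -/
theorem isPCTGood_one (hS : Continuous S) : IsPCTGood S hS 1 := by
  have hSS : S rotPi * S rotPi⁻¹ = 1 := by rw [← map_mul, mul_inv_cancel, map_one]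
  simp only [IsPCTGood, map_one, mul_one, boostIPi_mul_boostIPiInv, hSS]

/-- Products of good elements are good. [folklore] -/
theorem IsPCTGood.mul (hS : Continuous S) {g g' : SL(2, ℂ)} (hg : IsPCTGood S hS g) (hg' : IsPCTGood S hS g') :
    IsPCTGood S hS (g * g') := by
  have hSS' : S rotPi⁻¹ * S rotPi = 1 := by rw [← map_mul, inv_mul_cancel, map_one]
  unfold IsPCTGood at *
  calc boostIPi S hS * S (g * g') * boostIPiInv S hS
      = (boostIPi S hS * S g * boostIPiInv S hS) * (boostIPi S hS * S g' * boostIPiInv S hS) := by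
        rw [map_mul]
        simp only [mul_assoc]
        rw [← mul_assoc (boostIPiInv S hS) (boostIPi S hS), boostIPiInv_mul_boostIPi, one_mul]
    _ = S rotPi * S g * S rotPi⁻¹ * (S rotPi * S g' * S rotPi⁻¹) := by rw [hg, hg']
    _ = S rotPi * S (g * g') * S rotPi⁻¹ := by
        rw [map_mul]
        simp only [mul_assoc]
        rw [← mul_assoc (S rotPi⁻¹) (S rotPi), hSS', one_mul]

/-- The upper unipotents `u(β)` are good. [cite: StreaterWightman1964, §4-3 eq. (4-29)] -/
theorem isPCTGood_upper (hS : Continuous S) (β : ℂ) (t : ℝ) :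
    IsPCTGood S hS (toSL (β • eMat) (isGen_smul_eMat β) t) :=
  boostIPi_mul_apply_toSL_mul_boostIPiInv S hS _
    (boostIPi_mul_gen_mul_boostIPiInv S hS _ (Or.inl rfl)
      (fun s => by rw [diagGrp_mul_smul_eMat_mul_diagGrp_neg]; ring_nf)
      (rotPi_mul_smul_eMat_mul_rotPi_inv β)) t

/-- The lower unipotents `v(γ)` are good. [cite: StreaterWightman1964, §4-3 eq. (4-29)] -/
theorem isPCTGood_lower (hS : Continuous S) (γ : ℂ) (t : ℝ) :
    IsPCTGood S hS (toSL (γ • fMat) (isGen_smul_fMat γ) t) :=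
  boostIPi_mul_apply_toSL_mul_boostIPiInv S hS _
    (boostIPi_mul_gen_mul_boostIPiInv S hS _ (Or.inr rfl)
      (fun s => by rw [diagGrp_mul_smul_fMat_mul_diagGrp_neg]; ring_nf)
      (rotPi_mul_smul_fMat_mul_rotPi_inv γ)) t

/-- The real diagonal subgroup is good. [folklore] -/
theorem isPCTGood_diag (hS : Continuous S) (t : ℝ) : IsPCTGood S hS (toSL hMat isGen_hMat t) :=
  boostIPi_mul_apply_toSL_mul_boostIPiInv S hS _
    (boostIPi_mul_gen_mul_boostIPiInv_of_comm S hS isGen_hMat toSL_hMat_comm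
      (fun s => toSL_I_smul_hMat_mul_toSL_hMat (π / 2) s)) t

/-- The compact diagonal subgroup is good. [folklore] -/
theorem isPCTGood_rot3 (hS : Continuous S) (θ : ℝ) : IsPCTGood S hS (toSL ((I : ℂ) • hMat) isGen_I_smul_hMat θ) := by
  refine boostIPi_mul_apply_toSL_mul_boostIPiInv S hS _
    (boostIPi_mul_gen_mul_boostIPiInv_of_comm S hS isGen_I_smul_hMat
      (fun s t => (toSL_I_smul_hMat_mul_toSL_hMat t s).symm) (fun t => ?_)) θ
  rw [rotPi, ← toSL_add, ← toSL_add, add_comm]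

/-- **Gauss decomposition**: for `a ≠ 0`,
`!![a, b; c, d] = v(c/a) · diag(|a|, |a|⁻¹) · diag(e^{i arg a}, e^{−i arg a}) · u(b/a)`. [folklore] -/
theorem gauss_decomposition (g : SL(2, ℂ)) (ha : g 0 0 ≠ 0) :
    g = toSL ((g 1 0 / g 0 0) • fMat) (isGen_smul_fMat _) 1 *
        (toSL hMat isGen_hMat (Real.log ‖g 0 0‖) *
          (toSL ((I : ℂ) • hMat) isGen_I_smul_hMat (Complex.arg (g 0 0)) *
            toSL ((g 0 1 / g 0 0) • eMat) (isGen_smul_eMat _) 1)) := by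
  obtain ⟨M, hM⟩ := g
  change M 0 0 ≠ 0 at ha
  have hdet : M 0 0 * M 1 1 - M 0 1 * M 1 0 = 1 := by rwa [Matrix.det_fin_two] at hM
  -- polar form of `a = M 0 0`
  have hexpx : Complex.exp (Real.log ‖M 0 0‖ : ℝ) = (‖M 0 0‖ : ℂ) := by
    rw [← Complex.ofReal_exp, Real.exp_log (norm_pos_iff.2 ha)]
  have hpolar : Complex.exp (Real.log ‖M 0 0‖ : ℝ) * Complex.exp ((Complex.arg (M 0 0) : ℝ) * I) = M 0 0 := by
    rw [hexpx, Complex.norm_mul_exp_arg_mul_I]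
  have hpolar' : Complex.exp (-(Real.log ‖M 0 0‖ : ℝ)) * Complex.exp (-((Complex.arg (M 0 0) : ℝ) * I)) =
      (M 0 0)⁻¹ := by
    rw [Complex.exp_neg, Complex.exp_neg, ← mul_inv, hpolar]
  have e11 : (Complex.cosh (Real.log ‖M 0 0‖ : ℝ) + Complex.sinh (Real.log ‖M 0 0‖ : ℝ)) *
      (Complex.cos (Complex.arg (M 0 0) : ℝ) + Complex.sin (Complex.arg (M 0 0) : ℝ) * I) = M 0 0 := by
    rw [Complex.cosh_add_sinh, ← Complex.exp_mul_I, hpolar]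
  have e22 : (Complex.cosh (Real.log ‖M 0 0‖ : ℝ) - Complex.sinh (Real.log ‖M 0 0‖ : ℝ)) *
      (Complex.cos (Complex.arg (M 0 0) : ℝ) - Complex.sin (Complex.arg (M 0 0) : ℝ) * I) = (M 0 0)⁻¹ := by
    have h : Complex.cos (Complex.arg (M 0 0) : ℝ) - Complex.sin (Complex.arg (M 0 0) : ℝ) * I =
        Complex.exp (-((Complex.arg (M 0 0) : ℝ) * I)) := by
      rw [show -(((Complex.arg (M 0 0) : ℝ) : ℂ) * I) = (-((Complex.arg (M 0 0) : ℝ) : ℂ)) * I by ring,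
        Complex.exp_mul_I, Complex.cos_neg, Complex.sin_neg]
      ring
    rw [Complex.cosh_sub_sinh, h, hpolar']
  apply Subtype.ext
  change M = _
  rw [Matrix.SpecialLinearGroup.coe_mul, Matrix.SpecialLinearGroup.coe_mul, Matrix.SpecialLinearGroup.coe_mul,
    coe_toSL_smul_fMat_one, coe_toSL_smul_eMat_one, coe_toSL_hMat, coe_toSL_I_smul_hMat]
  change M = !![1, 0; M 1 0 / M 0 0, 1] * (diagGrp (Real.log ‖M 0 0‖) *
    (rot3Grp (Complex.arg (M 0 0)) * !![1, M 0 1 / M 0 0; 0, 1]))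
  simp only [diagGrp, rot3Grp, hMat]
  ext i j
  fin_cases i <;> fin_cases j
  · -- (0,0): `a`
    simp [Matrix.mul_apply, Fin.sum_univ_two, -Complex.cosh_add_sinh, -Complex.sinh_add_cosh,
      -Complex.cosh_sub_sinh, -Complex.sinh_sub_cosh]
    linear_combination -e11
  · -- (0,1): `a · (b/a) = b`
    simp [Matrix.mul_apply, Fin.sum_univ_two, -Complex.cosh_add_sinh, -Complex.sinh_add_cosh,
      -Complex.cosh_sub_sinh, -Complex.sinh_sub_cosh]
    have hb : M 0 0 * (M 0 1 / M 0 0) = M 0 1 := mul_div_cancel₀ _ ha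
    linear_combination -(M 0 1 / M 0 0) * e11 - hb
  · -- (1,0): `(c/a) · a = c`
    simp [Matrix.mul_apply, Fin.sum_univ_two, -Complex.cosh_add_sinh, -Complex.sinh_add_cosh,
      -Complex.cosh_sub_sinh, -Complex.sinh_sub_cosh]
    have hc : M 1 0 / M 0 0 * M 0 0 = M 1 0 := div_mul_cancel₀ _ ha
    linear_combination -(M 1 0 / M 0 0) * e11 - hc
  · -- (1,1): `(c/a) a (b/a) + a⁻¹ = d`
    simp [Matrix.mul_apply, Fin.sum_univ_two, -Complex.cosh_add_sinh, -Complex.sinh_add_cosh,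
      -Complex.cosh_sub_sinh, -Complex.sinh_sub_cosh]
    have hd : M 1 0 / M 0 0 * M 0 0 * (M 0 1 / M 0 0) + (M 0 0)⁻¹ = M 1 1 := by
      field_simp
      linear_combination -hdet
    linear_combination -(M 1 0 / M 0 0) * (M 0 1 / M 0 0) * e11 - e22 - hd

/-- The Weyl element `w₀ = !![0, 1; −1, 0] = u(1) v(−1) u(1)`. [folklore] -/
theorem weyl_eq :
    toSL ((1 : ℂ) • eMat) (isGen_smul_eMat 1) 1 * toSL ((-1 : ℂ) • fMat) (isGen_smul_fMat (-1)) 1 *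
        toSL ((1 : ℂ) • eMat) (isGen_smul_eMat 1) 1 = toSL kMat isGen_kMat (π / 2) := by
  apply Subtype.ext
  rw [Matrix.SpecialLinearGroup.coe_mul, Matrix.SpecialLinearGroup.coe_mul, coe_toSL_smul_fMat_one,
    coe_toSL_smul_eMat_one, coe_toSL_kMat, rotGrp, Real.cos_pi_div_two, Real.sin_pi_div_two]
  ext i j; fin_cases i <;> fin_cases j <;> simp [Matrix.mul_apply, Fin.sum_univ_two, kMat]

/-- **Every element of `SL(2, ℂ)` is good**: Gauss decomposition when `a ≠ 0`, and `g = w₀ (w₀⁻¹ g)` with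
`w₀ = u(1) v(−1) u(1)` otherwise. [cite: StreaterWightman1964, §4-3 eq. (4-30)] -/
theorem isPCTGood (hS : Continuous S) (g : SL(2, ℂ)) : IsPCTGood S hS g := by
  -- the case `a ≠ 0`
  have hmain : ∀ g : SL(2, ℂ), g 0 0 ≠ 0 → IsPCTGood S hS g := by
    intro g ha
    rw [gauss_decomposition g ha]
    refine (isPCTGood_lower S hS _ 1).mul S hS ((isPCTGood_diag S hS _).mul S hS
      ((isPCTGood_rot3 S hS _).mul S hS (isPCTGood_upper S hS _ 1)))
  rcases ne_or_eq (g 0 0) 0 with ha | ha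
  · exact hmain g ha
  · set w : SL(2, ℂ) := toSL kMat isGen_kMat (π / 2) with hw
    have hwgood : IsPCTGood S hS w := by
      rw [hw, ← weyl_eq]
      exact ((isPCTGood_upper S hS 1 1).mul S hS (isPCTGood_lower S hS (-1) 1)).mul S hS (isPCTGood_upper S hS 1 1)
    have hw' : w⁻¹ = toSL kMat isGen_kMat (-(π / 2)) := by rw [hw, toSL_neg]
    -- `(w⁻¹ g)₀₀ = −c ≠ 0`
    have hdet : g 0 0 * g 1 1 - g 0 1 * g 1 0 = 1 := by
      have h := g.det_coe
      rw [Matrix.det_fin_two] at h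
      exact h
    have hc : g 1 0 ≠ 0 := by
      intro hc
      rw [ha, hc] at hdet
      simp at hdet
    have hentry : (w⁻¹ * g) 0 0 = -g 1 0 := by
      rw [hw']
      show ((toSL kMat isGen_kMat (-(π / 2)) : M2) * (g : M2)) 0 0 = -g 1 0
      rw [coe_toSL_kMat, rotGrp, Real.cos_neg, Real.sin_neg, Real.cos_pi_div_two, Real.sin_pi_div_two]
      simp [kMat, Matrix.mul_apply, Fin.sum_univ_two]
    have hgood' : IsPCTGood S hS (w⁻¹ * g) := hmain _ (by rw [hentry]; exact neg_ne_zero.2 hc)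
    have := hwgood.mul S hS hgood'
    rwa [mul_inv_cancel_left] at this

/-- **The continued boost acts like the rotation**: `exp ((iπ/2) H) S(g) exp (−(iπ/2) H) =
S(A_R) S(g) S(A_R)⁻¹` for every `g ∈ SL(2, ℂ)` (the representation-theoretic content of S–W
eqs. (4-29)–(4-30) for the complex Lorentz transformation `B(iπ) = (−1) ∘ R⁻¹`). [cite: StreaterWightman1964, §4-3 eqs. (4-29)–(4-30)] -/
theorem exp_genH_conj_apply (hS : Continuous S) (g : SL(2, ℂ)) :
    boostIPi S hS * S g * boostIPiInv S hS = S rotPi * S g * S rotPi⁻¹ :=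
  isPCTGood S hS g

/-- **The PCT matrix commutes with the representation.** [cite: StreaterWightman1964, Thm 4-7] -/
theorem commute_pctMatrix (hS : Continuous S) (g : SL(2, ℂ)) : Commute (pctMatrix S hS) (S g) := by
  have h := exp_genH_conj_apply S hS g
  have hSS' : S rotPi⁻¹ * S rotPi = 1 := by rw [← map_mul, inv_mul_cancel, map_one]
  -- multiply `U S(g) U⁻¹ = V S(g) V⁻¹` by `V⁻¹` on the left and `U` on the right
  have h2 : S rotPi⁻¹ * (boostIPi S hS * S g * boostIPiInv S hS) * boostIPi S hS =
      S rotPi⁻¹ * (S rotPi * S g * S rotPi⁻¹) * boostIPi S hS := by rw [h]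
  have lhs : S rotPi⁻¹ * (boostIPi S hS * S g * boostIPiInv S hS) * boostIPi S hS =
      pctMatrix S hS * S g := by
    simp only [pctMatrix, mul_assoc, boostIPiInv_mul_boostIPi, mul_one]
  have rhs : S rotPi⁻¹ * (S rotPi * S g * S rotPi⁻¹) * boostIPi S hS = S g * pctMatrix S hS := by
    rw [pctMatrix, ← mul_assoc, ← mul_assoc, hSS', one_mul, mul_assoc]
  rw [lhs, rhs] at h2
  exact h2

/-- `S(A_R)` commutes with `U = exp ((iπ/2) H)` (diagonal matrices commute). [folklore] -/
theorem commute_apply_rotPi_boostIPi (hS : Continuous S) : Commute (S rotPi) (boostIPi S hS) := by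
  have h : Commute (S rotPi) (gen S hS hMat isGen_hMat) :=
    commute_gen S hS rotPi isGen_hMat fun t => toSL_I_smul_hMat_mul_toSL_hMat (π / 2) t
  exact (h.smul_right _).exp_right

/-- `U² = exp (iπ H)`. [folklore] -/
theorem boostIPi_mul_boostIPi (hS : Continuous S) :
    boostIPi S hS * boostIPi S hS = exp (((π : ℂ) * I) • gen S hS hMat isGen_hMat) := by
  have h := (exp_add_of_commute (Commute.refl ((((π : ℂ) / 2) * I) • gen S hS hMat isGen_hMat))).symm
  rw [← add_smul, show ((π : ℂ) / 2) * I + ((π : ℂ) / 2) * I = (π : ℂ) * I by ring] at h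
  exact h

/-- **The PCT matrix is an involution**: `C² = S(A_R⁻²) exp (iπ H) = S(−1) S(−1) = 1`.
[cite: StreaterWightman1964, Thm 4-7] -/
theorem pctMatrix_mul_self (hS : Continuous S) : pctMatrix S hS * pctMatrix S hS = 1 := by
  cases isEmpty_or_nonempty ι with
  | inl h => exact Subsingleton.elim _ _
  | inr h =>
    have hcomm : Commute (S rotPi⁻¹) (boostIPi S hS) := by
      have h1 := commute_apply_rotPi_boostIPi S hS
      have hSS : S rotPi * S rotPi⁻¹ = 1 := by rw [← map_mul, mul_inv_cancel, map_one]
      have hSS' : S rotPi⁻¹ * S rotPi = 1 := by rw [← map_mul, inv_mul_cancel, map_one]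
      -- conjugate the commutation relation by `S(A_R)⁻¹`
      have : S rotPi⁻¹ * (S rotPi * boostIPi S hS) * S rotPi⁻¹ = S rotPi⁻¹ * (boostIPi S hS * S rotPi) * S rotPi⁻¹ := by
        rw [h1.eq]
      rw [← mul_assoc, hSS', one_mul, mul_assoc, mul_assoc, hSS, mul_one] at this
      exact this.symm
    have hinv2 : rotPi⁻¹ * rotPi⁻¹ = -1 := by
      rw [← mul_inv_rev, rotPi_mul_rotPi]
      exact inv_eq_of_mul_eq_one_right (by rw [neg_mul_neg, one_mul])
    have hneg : S (-1) * S (-1) = 1 := by rw [← map_mul, neg_mul_neg, one_mul, map_one]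
    calc pctMatrix S hS * pctMatrix S hS
        = S rotPi⁻¹ * (boostIPi S hS * S rotPi⁻¹) * boostIPi S hS := by simp only [pctMatrix, mul_assoc]
      _ = S rotPi⁻¹ * (S rotPi⁻¹ * boostIPi S hS) * boostIPi S hS := by rw [hcomm.eq]
      _ = S rotPi⁻¹ * S rotPi⁻¹ * (boostIPi S hS * boostIPi S hS) := by simp only [mul_assoc]
      _ = S (-1) * S (-1) := by rw [← map_mul, hinv2, boostIPi_mul_boostIPi, exp_pi_mul_I_smul_genH S hS]
      _ = 1 := hneg

/-- The generator of the trivial representation vanishes. [folklore] -/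
theorem gen_one {ξ : M2} (hξ : IsGen ξ) (h1 : Continuous (1 : SL(2, ℂ) →* Matrix ι ι ℂ)) :
    gen (1 : SL(2, ℂ) →* Matrix ι ι ℂ) h1 ξ hξ = 0 := by
  refine Literature.Analysis.OperatorTheory.generator_unique fun t => ?_
  show exp (t • gen (1 : SL(2, ℂ) →* Matrix ι ι ℂ) h1 ξ hξ) = exp (t • (0 : Matrix ι ι ℂ))
  rw [← apply_toSL (1 : SL(2, ℂ) →* Matrix ι ι ℂ) h1 hξ t, smul_zero, NormedSpace.exp_zero, MonoidHom.one_apply]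

/-- **For the trivial representation the PCT matrix is `1`.** [cite: StreaterWightman1964, Thm 4-7] -/
theorem pctMatrix_one (h1 : Continuous (1 : SL(2, ℂ) →* Matrix ι ι ℂ)) :
    pctMatrix (1 : SL(2, ℂ) →* Matrix ι ι ℂ) h1 = 1 := by
  rw [pctMatrix, boostIPi, gen_one, smul_zero, NormedSpace.exp_zero, MonoidHom.one_apply, one_mul]

/-- The PCT matrix of a representation that happens to be trivial (stated with `S = 1` as a
hypothesis, the form used by `pct_theorem`). [cite: StreaterWightman1964, Thm 4-7] -/
theorem pctMatrix_eq_one_of_eq_one (hS : Continuous S) (h : S = 1) : pctMatrix S hS = 1 := by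
  subst h
  exact pctMatrix_one hS

end Rep

end SL2C

end Literature.MathematicalPhysics.QuantumLattice
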